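import Summits.Ventures.HSemireg.WedgeHankelKernelColumnSpace
import Summits.Ventures.HSemireg.WedgeHankelDual
import Summits.Ventures.HSemireg.WedgeHankelBox

/-!
# Venture HSemireg — THE KERNEL IN ONE DEGREE DETERMINES THE KERNELS IN ALL LOWER DEGREES: for a homogeneous class `f` of degree `d` and `a + b + d ≤ |I|`,
# **`θ ∈ Kr(univ, f, a) ↔ E_U ∧ θ ∈ Kr(univ, f, b + a)` for every monomial `E_U` of degree `b`** (non-degeneracy of the top pairing), hence
# **`Kr(univ, f, b + a) ⊆ Kr(univ, g, b + a) ⇒ Kr(univ, f, a) ⊆ Kr(univ, g, a)`** for two classes of the same degree; for th-7's classes: containment or equality of the degree-`k` kernels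
# (`k ≤ N`) propagates to every degree `k′ ≤ k`, and so does M14's column-space control: `col H_k(q) ⊆ col H_k(q′) ⇒ Kr(w_N q′, k′) ⊆ Kr(w_N q, k′)` for all `k′ ≤ k`

HONEST FRAMING. Part of the Lean index of the computation cell `pub-hsemireg` (seat p10 gen 25, Sunday typer «UNIFORM-IN-n»).
Finite-dimensional EXTERIOR ALGEBRA over a field ONLY: no variety, no cohomology theory, no sheaf, no Ext group, no semiregularity map; nothing here says that HC / HC_CM / HC_AV holds;
no Literature fact is declared or used.  Custodian versions as in `WedgeHankelSiegelIdeal` (1/3) and `WedgeKernelDuality` (E1); the dictionary (`Kr(univ, f, a)` = the degree-`a` forms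
killing the class `f`; the kernels in the various degrees `a` as one «ideal-like» family) is QUOTED, never asserted.

WHAT IS IN THE TREE.  E1 (`WedgeKernelDuality`): `eq_zero_of_forall_top_mul_left` (NON-DEGENERACY: a non-zero form of degree `a′` is detected by `τ(η ∧ ·)` for `η` of the complementary
degree), `topCoeff`; `B_mul_B` (`E_V ∧ E_U = ±E_{V ∪ U}` for disjoint index sets, `u_ne_zero_iff`), `Wedge.mul_mem_Hom` (`WedgeHankelDual`), `B_mem_Hom`; C1 `Hom_mul_Kr_le` (disjoint
blocks, Künneth); M14 `Kr_w_anti_of_range_hankel1_le` (column-space control in ONE degree).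
THIS FILE (namespace `Summit.Ventures.HSemireg.Wedge.HankelOuter` continued; imports M14, `WedgeHankelDual`, `WedgeHankelBox` (`w_mem_Hom_univ`)):
* §446 ANY HOMOGENEOUS CLASS: `B_mul_mem_Kr` / `Hom_mul_Kr_univ_le` (`Hom(univ, b) ∧ Kr(univ, f, a) ⊆ Kr(univ, f, b + a)`), `eq_zero_of_forall_top_B_mul` (non-degeneracy, monomials on
  the left), **`mem_Kr_iff_forall_B_mul_mem_Kr`** (`a + b + d ≤ |I|`: `θ ∈ Kr(f, a) ↔ ∀ |U| = b, E_U ∧ θ ∈ Kr(f, b + a)` — the lower kernel is the «ideal quotient» of the higher one),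
  **`Kr_mono_of_Kr_add_mono`** (`Kr(f, b + a) ⊆ Kr(g, b + a) ⇒ Kr(f, a) ⊆ Kr(g, a)`), `Kr_eq_of_Kr_add_eq`.
* §447 TH-7's CLASSES: **`Kr_w_mono_of_le_degree`** (`k′ ≤ k ≤ N`: `Kr(w_N q, k) ⊆ Kr(w_N q′, k) ⇒ Kr(w_N q, k′) ⊆ Kr(w_N q′, k′)`), `Kr_w_eq_of_eq_degree` (THE DEGREE-`k` KERNEL DETERMINES
  ALL LOWER KERNELS), **`Kr_w_anti_of_range_hankel1_le_of_le`** (M14 propagated: `col H_k(q) ⊆ col H_k(q′) ⇒ Kr(w_N q′, k′) ⊆ Kr(w_N q, k′)` for every `k′ ≤ k ≤ N`),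
  `Kr_w_eq_of_range_hankel1_eq_of_le`.
READING: the kernels of one class in the degrees `0, 1, …, N` are not independent data: each determines all the lower ones (and, by E1's duality, the images in the degrees `≥ N − k`
determine the higher images).  With N5 (keyed: the kernel in degree `k` IS the column space `col H_k(q)`), this is the matrix fact that `col H_k(q)` determines `col H_{k′}(q)` for
`k′ ≤ k` (the columns of `H_{k′}` are truncated columns of `H_k`).  Nothing Ext-side.  New names only.
-/

open Module

namespace Summit.Ventures.HSemireg.Wedge.HankelOuter

open Summit.Ventures.HSemireg.Wedge Summit.Ventures.HSemireg.Wedge.Kunneth Summit.Ventures.HSemireg.Wedge.Hankel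
  Summit.Ventures.HSemireg.Wedge.BasisFree Summit.Ventures.HSemireg.Wedge.HankelSiegel Summit.Ventures.HSemireg.Wedge.HankelSiegelIdeal
  Summit.Ventures.HSemireg.Wedge.KunnethKernel Summit.Ventures.HSemireg.Wedge.HankelFrameChange Summit.Ventures.HSemireg.Wedge.KernelDuality

variable (K : Type*) [Field K]

section General

variable {I : Type*} [LinearOrder I] [Fintype I]

/-! ## §446. Any homogeneous class: the lower kernel is the ideal quotient of the higher one -/

/-- `θ ∈ Kr(univ, f, a)`, `|U| = b` ⇒ `E_U ∧ θ ∈ Kr(univ, f, b + a)`. -/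
theorem B_mul_mem_Kr {f θ : HT K I} {a b : ℕ} (hθ : θ ∈ Kr K (Finset.univ : Finset I) f a) {U : Finset I} (hU : U.card = b) :
    B K I U * θ ∈ Kr K (Finset.univ : Finset I) f (b + a) := by
  obtain ⟨hθa, hθ0⟩ := mem_Kr.mp hθ
  exact mem_Kr.mpr ⟨Wedge.mul_mem_Hom K (B_mem_Hom K (Finset.subset_univ U) hU) hθa, by rw [mul_assoc, hθ0, mul_zero]⟩

/-- **`Hom(univ, b) ∧ Kr(univ, f, a) ⊆ Kr(univ, f, b + a)`**: the kernels of one class form an ideal-like family across the degrees. -/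
theorem Hom_mul_Kr_univ_le (f : HT K I) (a b : ℕ) :
    Hom K I (Finset.univ : Finset I) b * Kr K (Finset.univ : Finset I) f a ≤ Kr K (Finset.univ : Finset I) f (b + a) := by
  rw [Submodule.mul_le]
  intro η hη θ hθ
  obtain ⟨hθa, hθ0⟩ := mem_Kr.mp hθ
  exact mem_Kr.mpr ⟨Wedge.mul_mem_Hom K hη hθa, by rw [mul_assoc, hθ0, mul_zero]⟩

/-- NON-DEGENERACY with monomials on the left: a homogeneous `x` of degree `a′` with `τ(E_W ∧ x) = 0` for every `|W| = b′`, `b′ + a′ = |I|`, is zero (E1 `eq_zero_of_forall_top_mul_left`,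
the `E_W` spanning `Hom(univ, b′)`). -/
theorem eq_zero_of_forall_top_B_mul {a' b' : ℕ} (hab : b' + a' = Fintype.card I) {x : HT K I} (hx : x ∈ Hom K I Finset.univ a')
    (h : ∀ W : Finset I, W.card = b' → topCoeff K (B K I W * x) = 0) : x = 0 := by
  refine eq_zero_of_forall_top_mul_left K hab hx fun η hη => ?_
  induction hη using Submodule.span_induction with
  | mem y hy =>
    obtain ⟨W, ⟨_, hW⟩, rfl⟩ := hy
    exact h W hW
  | zero => rw [zero_mul, map_zero]
  | add y z _ _ hy hz => rw [add_mul, map_add, hy, hz, add_zero]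
  | smul c y _ hy => rw [smul_mul_assoc, map_smul, hy, smul_zero]

/-- **THE LOWER KERNEL IS THE IDEAL QUOTIENT OF THE HIGHER ONE: for `f` homogeneous of degree `d`, `θ` of degree `a` and `a + b + d ≤ |I|`,
`θ ∈ Kr(univ, f, a) ↔ ∀ |U| = b, E_U ∧ θ ∈ Kr(univ, f, b + a)`** — `⇐`: if `θ ∧ f ≠ 0`, some monomial `E_W` of the complementary degree pairs non-trivially with it (non-degeneracy);
splitting `E_W = ±E_V ∧ E_U` with `|U| = b` exhibits `E_U ∧ θ ∧ f ≠ 0`. -/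
theorem mem_Kr_iff_forall_B_mul_mem_Kr {f θ : HT K I} {a b d : ℕ} (habd : a + b + d ≤ Fintype.card I) (hf : f ∈ Hom K I Finset.univ d) (hθ : θ ∈ Hom K I Finset.univ a) :
    θ ∈ Kr K (Finset.univ : Finset I) f a ↔ ∀ U : Finset I, U.card = b → B K I U * θ ∈ Kr K (Finset.univ : Finset I) f (b + a) := by
  refine ⟨fun h U hU => B_mul_mem_Kr K h hU, fun h => ?_⟩
  refine mem_Kr.mpr ⟨hθ, ?_⟩
  by_contra hne
  have hx : θ * f ∈ Hom K I Finset.univ (a + d) := Wedge.mul_mem_Hom K hθ hf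
  -- a monomial of the complementary degree pairing non-trivially with `θ ∧ f`
  have hW : ∃ W : Finset I, W.card = Fintype.card I - (a + d) ∧ topCoeff K (B K I W * (θ * f)) ≠ 0 := by
    by_contra hall
    simp only [not_exists, not_and, ne_eq, not_not] at hall
    exact hne (eq_zero_of_forall_top_B_mul K (by omega) hx hall)
  obtain ⟨W, hWc, hWne⟩ := hW
  obtain ⟨U, hUW, hU⟩ := Finset.exists_subset_card_eq (show b ≤ W.card by omega)
  have hVU : Disjoint (W \ U) U := Finset.sdiff_disjoint
  have hsplit : B K I (W \ U) * B K I U = u K (W \ U) U • B K I W := by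
    rw [B_mul_B, Finset.sdiff_union_of_subset hUW]
  have hmem := mem_Kr.mp (h U hU)
  apply hWne
  have e2 : B K I (W \ U) * (B K I U * θ * f) = u K (W \ U) U • (B K I W * (θ * f)) := by
    rw [show B K I U * θ * f = B K I U * (θ * f) from mul_assoc _ _ _, ← mul_assoc, hsplit, smul_mul_assoc]
  have hzero : B K I W * (θ * f) = 0 := by
    have h3 : u K (W \ U) U • (B K I W * (θ * f)) = 0 := by rw [← e2, hmem.2, mul_zero]
    exact (smul_eq_zero.mp h3).resolve_left ((u_ne_zero_iff K).mpr hVU)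
  rw [hzero, map_zero]

/-- **CONTAINMENT DESCENDS: `Kr(univ, f, b + a) ⊆ Kr(univ, g, b + a) ⇒ Kr(univ, f, a) ⊆ Kr(univ, g, a)`** for `f, g` homogeneous of degree `d`, `a + b + d ≤ |I|`. -/
theorem Kr_mono_of_Kr_add_mono {f g : HT K I} {a b d : ℕ} (habd : a + b + d ≤ Fintype.card I) (hf : f ∈ Hom K I Finset.univ d) (hg : g ∈ Hom K I Finset.univ d)
    (h : Kr K (Finset.univ : Finset I) f (b + a) ≤ Kr K (Finset.univ : Finset I) g (b + a)) :
    Kr K (Finset.univ : Finset I) f a ≤ Kr K (Finset.univ : Finset I) g a := by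
  have _ := hf
  intro θ hθ
  have hθa : θ ∈ Hom K I Finset.univ a := (mem_Kr.mp hθ).1
  exact (mem_Kr_iff_forall_B_mul_mem_Kr K habd hg hθa).mpr fun U hU => h (B_mul_mem_Kr K hθ hU)

/-- **EQUALITY DESCENDS: `Kr(univ, f, b + a) = Kr(univ, g, b + a) ⇒ Kr(univ, f, a) = Kr(univ, g, a)`** (same hypotheses). -/
theorem Kr_eq_of_Kr_add_eq {f g : HT K I} {a b d : ℕ} (habd : a + b + d ≤ Fintype.card I) (hf : f ∈ Hom K I Finset.univ d) (hg : g ∈ Hom K I Finset.univ d)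
    (h : Kr K (Finset.univ : Finset I) f (b + a) = Kr K (Finset.univ : Finset I) g (b + a)) :
    Kr K (Finset.univ : Finset I) f a = Kr K (Finset.univ : Finset I) g a :=
  le_antisymm (Kr_mono_of_Kr_add_mono K habd hf hg h.le) (Kr_mono_of_Kr_add_mono K habd hg hf h.ge)

end General

/-! ## §447. th-7's classes: containment of the degree-`k` kernels propagates to every lower degree -/

variable {N : ℕ}

/-- **CONTAINMENT PROPAGATES DOWNWARD IN DEGREE: for `k′ ≤ k ≤ N`, `Kr(univ, w_N q, k) ⊆ Kr(univ, w_N q′, k) ⇒ Kr(univ, w_N q, k′) ⊆ Kr(univ, w_N q′, k′)`** (every field). -/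
theorem Kr_w_mono_of_le_degree {k k' : ℕ} (hk' : k' ≤ k) (hk : k ≤ N) {q q' : ℕ → K}
    (h : Kr K (Finset.univ : Finset (In N)) (w K N N q) k ≤ Kr K (Finset.univ : Finset (In N)) (w K N N q') k) :
    Kr K (Finset.univ : Finset (In N)) (w K N N q) k' ≤ Kr K (Finset.univ : Finset (In N)) (w K N N q') k' := by
  have e : k = (k - k') + k' := by omega
  rw [e] at h
  exact Kr_mono_of_Kr_add_mono K (a := k') (b := k - k') (d := N) (by rw [Fintype.card_fin]; omega) (HankelBox.w_mem_Hom_univ K N q) (HankelBox.w_mem_Hom_univ K N q') h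

/-- **THE DEGREE-`k` KERNEL DETERMINES ALL LOWER KERNELS: `Kr(univ, w_N q, k) = Kr(univ, w_N q′, k) ⇒ Kr(univ, w_N q, k′) = Kr(univ, w_N q′, k′)`** for `k′ ≤ k ≤ N`. -/
theorem Kr_w_eq_of_eq_degree {k k' : ℕ} (hk' : k' ≤ k) (hk : k ≤ N) {q q' : ℕ → K}
    (h : Kr K (Finset.univ : Finset (In N)) (w K N N q) k = Kr K (Finset.univ : Finset (In N)) (w K N N q') k) :
    Kr K (Finset.univ : Finset (In N)) (w K N N q) k' = Kr K (Finset.univ : Finset (In N)) (w K N N q') k' :=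
  le_antisymm (Kr_w_mono_of_le_degree K hk' hk h.le) (Kr_w_mono_of_le_degree K hk' hk h.ge)

/-- **M14 PROPAGATED: `col H_k(q) ⊆ col H_k(q′) ⇒ Kr(univ, w_N q′, k′) ⊆ Kr(univ, w_N q, k′)` for EVERY `k′ ≤ k ≤ N`** — column-space control in degree `k` governs all lower
degrees. -/
theorem Kr_w_anti_of_range_hankel1_le_of_le {k k' : ℕ} (hk' : k' ≤ k) (hk : k ≤ N) {q q' : ℕ → K}
    (h : LinearMap.range (hankel1 K N k q).mulVecLin ≤ LinearMap.range (hankel1 K N k q').mulVecLin) :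
    Kr K (Finset.univ : Finset (In N)) (w K N N q') k' ≤ Kr K (Finset.univ : Finset (In N)) (w K N N q) k' :=
  Kr_w_mono_of_le_degree K hk' hk (Kr_w_anti_of_range_hankel1_le K k h)

/-- **`col H_k(q) = col H_k(q′) ⇒ Kr(univ, w_N q, k′) = Kr(univ, w_N q′, k′)` for every `k′ ≤ k ≤ N`.** -/
theorem Kr_w_eq_of_range_hankel1_eq_of_le {k k' : ℕ} (hk' : k' ≤ k) (hk : k ≤ N) {q q' : ℕ → K}
    (h : LinearMap.range (hankel1 K N k q).mulVecLin = LinearMap.range (hankel1 K N k q').mulVecLin) :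
    Kr K (Finset.univ : Finset (In N)) (w K N N q) k' = Kr K (Finset.univ : Finset (In N)) (w K N N q') k' :=
  Kr_w_eq_of_eq_degree K hk' hk (Kr_w_eq_of_range_hankel1_eq K k h)

end Summit.Ventures.HSemireg.Wedge.HankelOuter
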